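import Mathlib
import Summits.NavierStokesRegularity.NavierStokesRegularity.Theorems.RootDecompLitSliceCubicFluxBudget
import Summits.NavierStokesRegularity.NavierStokesRegularity.Theorems.RootDecompLitSliceLocalEnergyBudget
import HarnessLib

/-!
# Route RootDecompLitSlice — cell Uᶜ `CritTameScarIsCritical` (stmt-NavierStokesRegularity-31733):
# the terminal-window local energy budget with the LOCAL ENERGY, the CUBIC FLUX and the WINDOW
# ENSTROPHY discharged — the scar law UNIFORM MODULO THE PRESSURE FLUX

Helpers toward the Tao-vacuous cell Uᶜ (`--supports 31733`; no item, no node, no registered stub).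
`LocalEnergyBudget.scar_le_of_fluxBudget` (landed) bounds the scar `∫_{B(x₀,r)}|u(T)|²` by the
`L²`-modulus `H`, the clock `τ`, the cutoff constants and four HYPOTHESIS NUMBERS: the local energy
`a`, the cubic flux `m₃`, the pressure flux `mpu` (critic row 665 (c3)). Here three of them are paid
from frame data, leaving ONLY the pressure flux `mpu`:

* `CubicFlux.windowEnstrophy_le_of_modulus` — `∫_{T−τ}^{T}∫|∇u|²_F ≤ ‖u₀‖₂ √H / ν`
  (landed `EnergyDrain.dissipation_le_energy_sub`: dissipation ≤ energy drop, final time included;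
  landed `GeneralWindowTradeoff.stub_energyDrop_le_modulus`: drop ≤ `2‖u₀‖₂√H`);
* `CubicFlux.cubicFlux_le_of_modulus` — `∬_{(T−τ,t₁)×B_R}|u|³ ≤ K^{3/2} a^{3/4} τ^{1/4}
  (‖u₀‖₂√H/ν)^{3/4}` (landed `CubicFlux.cubicFlux_le` + the previous bullet);
* `CubicFlux.localEnergy_le_of_modulus` — on the window, `∫_{B_R}|u(s)|² ≤ (√H + √(∫_{B_R}|u(T)|²))²`
  (landed `LocalWindowTradeoff.localMass_le_sq_sqrt_add`, read backwards in time);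
* ★ `LocalEnergyBudget.scar_le_of_pressureBudget` — the assembled law: for every admissible cutoff
  and every pressure budget `mpu ≥ ∬|p − c(t)||u|` on the sub-windows,
  `∫_{B_r}|u(T)|² ≤ 2H + 16 (r²/(ντ)) · (Rel(H) + ν C_Δ A τ + C_∇ M₃ + 2 C_∇ mpu)/2
     + c₀ (r/ρ)² (H + ∫_{B_ρ}|u(T)|²)`,
  `A = (√H + ‖u(T)‖_{L²(B_R)})²`, `M₃ = K^{3/2} A^{3/4} τ^{1/4} (‖u₀‖₂√H/ν)^{3/4}`,
  `Rel(H) = 4H + 4√H √(2H + 2‖u(T)‖²_{L²(B_R)})` — every quantity on the right except `mpu` and the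
  two cutoff constants is FRAME DATA (`H, τ, ν, ‖u₀‖₂` and local masses of the terminal value).

What it is NOT: a proof of Uᶜ. The pressure flux needs the `ℝ³` Riesz representation of the
classical Leray–Hopf pressure (tree: only `IsKatoSolutionOn.exists_rieszPressure_suitable_slab`),
and the bootstrap in `r` is exponent algebra on top (census #46b/#47b). HONEST FRAMING: helper
lemmas INSIDE the Tao-vacuous cell Uᶜ; zero load of the route moves (ROOT ⟺ U ∧ P1, critic rows
354/371/563/639/665); no item is re-typed. Rung 0. Decomp-ns route-writer g39. [folklore]
-/

set_option linter.dupNamespace false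

noncomputable section

namespace Summit.NavierStokesRegularity.NavierStokesRegularity.Theorems

open MeasureTheory TopologicalSpace Set Function Filter Metric
open _root_.Topology
open scoped Laplacian InnerProductSpace RealInnerProductSpace ENNReal NNReal ContDiff
open Literature.Analysis.FluidPDE

namespace CubicFlux

/-- **Window enstrophy ≤ ‖u₀‖₂√H/ν.** Frame: `ν > 0`, classical on `[0,T) × ℝ³`, Leray–Hopf on
`[0,T]` from `u 0`, decay of `u 0` (carried); `∫⁻‖u(T−τ) − u(T)‖ₑ² ≤ H`. Then
`∫_{T−τ}^{T}∫|∇u|²_F ≤ √(∫|u₀|²) √H / ν` (dissipation ≤ kinetic-energy drop ≤ ½·2‖u₀‖₂√H).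
[cite: RobinsonRodrigoSadowski2016, Def. 4.9 and Cor. 4.8] -/
theorem windowEnstrophy_le_of_modulus {ν T : ℝ} (hν : 0 < ν) (hT : 0 < T)
    {u : ℝ → EuclideanSpace ℝ (Fin 3) → EuclideanSpace ℝ (Fin 3)}
    {p : ℝ → EuclideanSpace ℝ (Fin 3) → ℝ}
    (hcl : IsClassicalNSSolutionOn (Set.Ico 0 T) ν 0 u p) (hLH : IsLerayHopfOn T ν 0 (u 0) u)
    (hdec : HasRapidSpatialDecay (u 0)) {τ H : ℝ} (hτ : 0 < τ) (hτT : τ < T) (hH : 0 ≤ H)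
    (hmod : ∫⁻ x, ‖u (T - τ) x - u T x‖ₑ ^ 2 ≤ ENNReal.ofReal H) :
    ∫⁻ t in Ioo (T - τ) T, ∫⁻ x, ENNReal.ofReal (frobeniusNormSq (fderiv ℝ (u t) x)) ≤
      ENNReal.ofReal (Real.sqrt (∫ x, ‖u 0 x‖ ^ 2) * Real.sqrt H / ν) := by
  have h0 : 0 ≤ T - τ := by linarith
  obtain ⟨hfin, hle⟩ := CertifiedBlowupAxisymBlowup.EnergyDrain.dissipation_le_energy_sub hν hcl
    hLH h0 (by linarith : T - τ ≤ T) le_rfl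
  have hdrop := GeneralWindowTradeoff.stub_energyDrop_le_modulus ν T hν hT u p hcl hLH hdec
    (T - τ) ⟨h0, by linarith⟩ H hH hmod
  set D : ℝ≥0∞ := ∫⁻ t in Ioo (T - τ) T, ∫⁻ x, ENNReal.ofReal (frobeniusNormSq (fderiv ℝ (u t) x))
    with hD
  have hKE : VectorCalculus.kineticEnergy (u (T - τ)) - VectorCalculus.kineticEnergy (u T) ≤
      Real.sqrt (∫ x, ‖u 0 x‖ ^ 2) * Real.sqrt H := by
    simp only [VectorCalculus.kineticEnergy]
    linarith
  have hG : D.toReal ≤ Real.sqrt (∫ x, ‖u 0 x‖ ^ 2) * Real.sqrt H / ν := by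
    rw [le_div_iff₀ hν]
    have := hle.trans hKE
    linarith [mul_comm ν D.toReal]
  calc D = ENNReal.ofReal D.toReal := (ENNReal.ofReal_toReal hfin).symm
    _ ≤ _ := ENNReal.ofReal_le_ofReal hG

/-- ★ **The cubic flux from frame data: local energy, clock, modulus.** Frame as in
`windowEnstrophy_le_of_modulus`; `∫_{B(x₀,R)}|u(s)|² ≤ a` on `[T − τ, T)`. Then for every
`t₁ ∈ (T − τ, T)`:
`∬_{(T−τ,t₁)×B(x₀,R)}|u|³ ≤ K^{3/2} a^{3/4} τ^{1/4} (√(∫|u₀|²)√H/ν)^{3/4}`,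
`K = SNormLESNormFDerivOfEqConst ℝ³ volume 2`. [cite: Evans2010, §5.6.1 Thm. 1–2] -/
theorem cubicFlux_le_of_modulus {ν T : ℝ} (hν : 0 < ν) (hT : 0 < T)
    {u : ℝ → EuclideanSpace ℝ (Fin 3) → EuclideanSpace ℝ (Fin 3)}
    {p : ℝ → EuclideanSpace ℝ (Fin 3) → ℝ}
    (hcl : IsClassicalNSSolutionOn (Set.Ico 0 T) ν 0 u p) (hLH : IsLerayHopfOn T ν 0 (u 0) u)
    (hdec : HasRapidSpatialDecay (u 0)) (x₀ : EuclideanSpace ℝ (Fin 3)) (R : ℝ)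
    {τ t₁ a H : ℝ} (hτT : τ < T) (ht₁ : t₁ ∈ Ioo (T - τ) T)
    (ha : ∀ s ∈ Ico (T - τ) T, ∫ x in ball x₀ R, ‖u s x‖ ^ 2 ≤ a) (hH : 0 ≤ H)
    (hmod : ∫⁻ x, ‖u (T - τ) x - u T x‖ₑ ^ 2 ≤ ENNReal.ofReal H) :
    ∫ z in Ioo (T - τ) t₁ ×ˢ ball x₀ R, ‖u z.1 z.2‖ ^ 3 ≤
      ((SNormLESNormFDerivOfEqConst (EuclideanSpace ℝ (Fin 3))
          (volume : Measure (EuclideanSpace ℝ (Fin 3))) 2 : ℝ≥0) : ℝ) ^ (3 / 2 : ℝ) *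
        a ^ (3 / 4 : ℝ) *
          (τ ^ (1 / 4 : ℝ) * (Real.sqrt (∫ x, ‖u 0 x‖ ^ 2) * Real.sqrt H / ν) ^ (3 / 4 : ℝ)) := by
  have hτ : 0 < τ := by linarith [ht₁.1, ht₁.2]
  exact cubicFlux_le hcl hLH x₀ R hτT ht₁ ha (by positivity)
    (windowEnstrophy_le_of_modulus hν hT hcl hLH hdec hτ hτT hH hmod)

/-- **Local energy on the window from the terminal value and the modulus.** For `s ∈ [T − τ, T]`
with `∫⁻‖u(s) − u(T)‖ₑ² ≤ H`: `∫_{B(x₀,R)}|u(s)|² ≤ (√H + √(∫_{B(x₀,R)}|u(T)|²))²`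
(triangle inequality in `L²(B_R)`; the landed `LocalWindowTradeoff.localMass_le_sq_sqrt_add` with
the roles of the two times exchanged). [folklore] -/
theorem localEnergy_le_of_modulus {T : ℝ} {ν : ℝ}
    {u : ℝ → EuclideanSpace ℝ (Fin 3) → EuclideanSpace ℝ (Fin 3)}
    (hLH : IsLerayHopfOn T ν 0 (u 0) u) (hT : 0 < T) (x₀ : EuclideanSpace ℝ (Fin 3)) (R : ℝ)
    {s H : ℝ} (hs : s ∈ Icc 0 T) (hH : 0 ≤ H)
    (hmod : ∫⁻ x, ‖u s x - u T x‖ₑ ^ 2 ≤ ENNReal.ofReal H) :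
    ∫ x in ball x₀ R, ‖u s x‖ ^ 2 ≤
      (Real.sqrt H + Real.sqrt (∫ x in ball x₀ R, ‖u T x‖ ^ 2)) ^ 2 := by
  have hms : MemLp (u s) 2 volume := hLH.memLp s hs
  have hmT : MemLp (u T) 2 volume := hLH.memLp T ⟨hT.le, le_rfl⟩
  have hmod' : ∫⁻ x, ‖u T x - u s x‖ₑ ^ 2 ≤ ENNReal.ofReal H := by
    simpa only [enorm_sub_rev] using hmod
  exact LocalWindowTradeoff.localMass_le_sq_sqrt_add (u s) (u T) hms hmT x₀ R hH
    (integral_nonneg fun x => by positivity) hmod' le_rfl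

end CubicFlux

namespace LocalEnergyBudget

/-- ★★ **THE SCAR LAW, UNIFORM MODULO THE PRESSURE FLUX.** `LocalEnergyBudget.scar_le_of_fluxBudget`
with the local energy `a`, the cubic flux `m₃` (and through it the window enstrophy) DISCHARGED
from frame data: there are universal `c₀, K₀ ≥ 0` (`K₀ = K^{3/2}`, `K` the `ℝ³` Sobolev constant)
such that on the Uᶜ frame (`ν, T > 0`, classical on `[0,T)`, Leray–Hopf on `[0,T]`, decay of
`u 0`), for radii `0 < r`, `4r ≤ ρ`, a clock `0 < τ < T`, a modulus bound
`∫⁻‖u(t) − u(T)‖ₑ² ≤ H` on `[T − τ, T)`, an admissible cutoff `φ` (`C_c^∞`, `0 ≤ φ ≤ 1`, `= 1` on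
`B_ρ`, `tsupport φ ⊆ B_R`, `‖∇φ‖ ≤ C_∇`, `|Δφ| ≤ C_Δ`) and ANY pressure budget
`∬_{(T−τ,t₁)×B_R}|p − c(t)||u| ≤ mpu` (all `t₁ < T`):
`∫_{B_r}|u(T)|² ≤ 2H + 16 (r²/(ντ)) (Rel + (ν C_Δ A τ + C_∇ M₃ + 2 C_∇ mpu))/2 + c₀ (r/ρ)² (H + ∫_{B_ρ}|u(T)|²)`
with `A = (√H + √(∫_{B_R}|u(T)|²))²`, `M₃ = K₀ A^{3/4} τ^{1/4} (√(∫|u₀|²)√H/ν)^{3/4}`,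
`Rel = 4H + 4√H√(2H + 2∫_{B_R}|u(T)|²)`. [cite: CaffarelliKohnNirenberg1982, §2 eq. (2.4)] -/
theorem scar_le_of_pressureBudget : ∃ c₀ K₀ : ℝ, 0 ≤ c₀ ∧ 0 ≤ K₀ ∧
    ∀ (ν T : ℝ), 0 < ν → 0 < T →
    ∀ (u : ℝ → EuclideanSpace ℝ (Fin 3) → EuclideanSpace ℝ (Fin 3))
      (p : ℝ → EuclideanSpace ℝ (Fin 3) → ℝ),
      IsClassicalNSSolutionOn (Set.Ico 0 T) ν 0 u p →
      IsLerayHopfOn T ν 0 (u 0) u →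
      HasRapidSpatialDecay (u 0) →
      ∀ (x₀ : EuclideanSpace ℝ (Fin 3)) (r ρ R τ H : ℝ),
        0 < r → 4 * r ≤ ρ → 0 < τ → τ < T → 0 ≤ H →
        (∀ t ∈ Set.Ico (T - τ) T, ∫⁻ x, ‖u t x - u T x‖ₑ ^ 2 ≤ ENNReal.ofReal H) →
        ∀ (φ : EuclideanSpace ℝ (Fin 3) → ℝ) (Cg CL : ℝ), ContDiff ℝ ∞ φ → HasCompactSupport φ →
          (∀ x, 0 ≤ φ x) → (∀ x, φ x ≤ 1) → (∀ x ∈ ball x₀ ρ, φ x = 1) →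
          tsupport φ ⊆ ball x₀ R → (∀ x, ‖fderiv ℝ φ x‖ ≤ Cg) → (∀ x, |(Δ φ) x| ≤ CL) → 0 ≤ Cg →
        ∀ (mpu : ℝ) (c : ℝ → ℝ),
          (∀ t₁ ∈ Ioo (T - τ) T, IntegrableOn
            (fun z : ℝ × EuclideanSpace ℝ (Fin 3) => |p z.1 z.2 - c z.1| * ‖u z.1 z.2‖)
            (Ioo (T - τ) t₁ ×ˢ ball x₀ R)) →
          (∀ t₁ ∈ Ioo (T - τ) T,
            ∫ z in Ioo (T - τ) t₁ ×ˢ ball x₀ R, |p z.1 z.2 - c z.1| * ‖u z.1 z.2‖ ≤ mpu) →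
        ∫ x in ball x₀ r, ‖u T x‖ ^ 2 ≤
          2 * H + 16 * (r ^ 2 / (ν * τ)) *
              ((4 * H + 4 * Real.sqrt H * Real.sqrt (2 * H + 2 * ∫ x in ball x₀ R, ‖u T x‖ ^ 2) +
                (ν * CL * ((Real.sqrt H + Real.sqrt (∫ x in ball x₀ R, ‖u T x‖ ^ 2)) ^ 2) * τ +
                  Cg * (K₀ * ((Real.sqrt H + Real.sqrt (∫ x in ball x₀ R, ‖u T x‖ ^ 2)) ^ 2) ^
                      (3 / 4 : ℝ) * (τ ^ (1 / 4 : ℝ) *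
                        (Real.sqrt (∫ x, ‖u 0 x‖ ^ 2) * Real.sqrt H / ν) ^ (3 / 4 : ℝ))) +
                  2 * Cg * mpu)) / 2) +
            c₀ * (r / ρ) ^ 2 * (H + ∫ x in ball x₀ ρ, ‖u T x‖ ^ 2) := by
  obtain ⟨c₀, hc₀, hB⟩ := scar_le_of_fluxBudget
  set K₀ : ℝ := ((SNormLESNormFDerivOfEqConst (EuclideanSpace ℝ (Fin 3))
    (volume : Measure (EuclideanSpace ℝ (Fin 3))) 2 : ℝ≥0) : ℝ) ^ (3 / 2 : ℝ) with hK₀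
  refine ⟨c₀, K₀, hc₀, by positivity, ?_⟩
  intro ν T hν hT u p hcl hLH hdec x₀ r ρ R τ H hr hρ hτ hτT hH hmod φ Cg CL hφ hφc hφ0 hφ1 hone
    hsupp hD hΔ hCg mpu c hq hpu
  set A : ℝ := (Real.sqrt H + Real.sqrt (∫ x in ball x₀ R, ‖u T x‖ ^ 2)) ^ 2 with hA
  have h0 : 0 < T - τ := by linarith
  -- the local energy on the window
  have ha : ∀ s ∈ Ico (T - τ) T, ∫ x in ball x₀ R, ‖u s x‖ ^ 2 ≤ A := fun s hs =>
    CubicFlux.localEnergy_le_of_modulus hLH hT x₀ R ⟨h0.le.trans hs.1, hs.2.le⟩ hH (hmod s hs)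
  -- the cubic flux on every sub-window
  have h3 : ∀ t₁ ∈ Ioo (T - τ) T, ∫ z in Ioo (T - τ) t₁ ×ˢ ball x₀ R, ‖u z.1 z.2‖ ^ 3 ≤
      K₀ * A ^ (3 / 4 : ℝ) * (τ ^ (1 / 4 : ℝ) *
        (Real.sqrt (∫ x, ‖u 0 x‖ ^ 2) * Real.sqrt H / ν) ^ (3 / 4 : ℝ)) := fun t₁ ht₁ =>
    CubicFlux.cubicFlux_le_of_modulus hν hT hcl hLH hdec x₀ R hτT ht₁ ha hH
      (hmod (T - τ) ⟨le_rfl, by linarith⟩)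
  exact hB ν T hν hT u p hcl hLH hdec x₀ r ρ R τ H hr hρ hτ hτT hH hmod φ Cg CL hφ hφc hφ0 hφ1
    hone hsupp hD hΔ hCg A _ mpu c ha h3 hq hpu

end LocalEnergyBudget

end Summit.NavierStokesRegularity.NavierStokesRegularity.Theorems

end
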